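import Literature.MathematicalPhysics.QuantumManyBody.BoseEinsteinCondensation
import Literature.MathematicalPhysics.QuantumManyBody.SwapPurity
import Literature.MathematicalPhysics.QuantumManyBody.CondensateOccupationStability
import Summits.AtomisticToContinuum.BoseEinsteinCondensation.Theorems.BECSwapNoCatastropheSwapToZeroModeStability
import HarnessLib

/-!
# BECHardSphereReduction / HardCoreDominates — `L²`-stability of `λ_max(γ_Ψ)`
# (stub 2c of line `birth`)

Crux `HardCoreDominates` (stmt-AtomisticToContinuum-11884) of route `BECHardSphereReduction`,
line `birth`: the continuity step along the coupling path `v_t = v + t·1_{Iic R}` to the hard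
spheres compares the condensate numbers of `L²`-close near-minimisers, which needs that the largest
eigenvalue of the one-particle density matrix,
`λ_max(γ_Ψ) = maxOccupation N Ψ = sup_{‖φ‖₂ = 1} occupation N φ Ψ`
(`Literature.MathematicalPhysics.QuantumManyBody.BoseGas.maxOccupation`), is `L²`-stable on
admissible trial states. This file proves the registered stub `stub_maxOccupationStability`:

  `λ_max(γ_Φ) ≤ λ_max(γ_Ψ) + 2N ‖Φ - Ψ‖_{L²((ℝ³)^N)}`   for `Φ, Ψ : TrialState N L`.

Pure measure theory on `(ℝ³)^N`, no physics:

* `occupation_le_card_mul_lintegral_mul` — `occ_φ(Ψ) ≤ N ‖φ‖₂² ‖Ψ‖₂²` for an a.e.-measurable mode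
  and a measurable `Ψ` (Cauchy–Schwarz in the contracted particle, `sq_nnnorm_integral_mul_conj_le`,
  then Tonelli `∫ dY ∫ dx |Ψ(x::Y)|² = ‖Ψ‖₂²`, `lintegral_lintegral_sq_nnnorm_vecCons`); hence
  `occ_φ(Θ)^{1/2} ≤ N^{1/2}` for a normalised mode and a trial state
  (`occupation_rpow_half_le_card`);
* the seminorm property with the bound built in,
  `occ_φ(Φ)^{1/2} ≤ occ_φ(Ψ)^{1/2} + N^{1/2} ‖Φ - Ψ‖₂` (Minkowski in `L²((ℝ³)^{N-1})`), is the
  tree's `SwapToZeroMode.occupation_rpow_half_le_add` (phase `c = 1`) of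
  `Theorems/BECSwapNoCatastropheSwapToZeroModeStability.lean`;
* `occupation_le_maxOccupation_add` — the algebra `a ≤ b + d, a, b ≤ s, d ≤ s e ⇒ a² ≤ b² + 2s²e`
  (`sq_le_sq_add_of_le_add`) gives `occ_φ(Φ) ≤ occ_φ(Ψ) + 2N‖Φ - Ψ‖₂ ≤ λ_max(γ_Ψ) + 2N‖Φ - Ψ‖₂` for
  every normalised mode, and `stub_maxOccupationStability` is the supremum over modes (`N = 0`:
  all occupations vanish).
-/

noncomputable section

namespace Summit.AtomisticToContinuum.BoseEinsteinCondensation.Cruxes.HardCoreDominates.Birth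

open MeasureTheory
open scoped ENNReal NNReal ComplexConjugate
open Literature.MathematicalPhysics.QuantumManyBody.BoseGas
open Summit.AtomisticToContinuum.BoseEinsteinCondensation.Theorems
  (SwapToZeroMode.occupation_rpow_half_le_add)

/-- **`a_φ` is bounded by `√N ‖φ‖₂`**: `occ_φ(Ψ) ≤ N ‖φ‖₂² ‖Ψ‖₂²` for an a.e.-measurable mode `φ`
and a measurable `Ψ` (Cauchy–Schwarz in the contracted particle, then Tonelli
`∫ dY ∫ dx |Ψ(x::Y)|² = ‖Ψ‖₂²`); adapted from the private `occupation_le_mul_lintegral` of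
`Theorems/BECThomsonPrinciplePeriodicToDirichletNearMinimiserTransfer.lean`. [folklore] -/
theorem occupation_le_card_mul_lintegral_mul {φ : Space → ℂ} (hφ : AEMeasurable φ volume) :
    ∀ {N : ℕ} {Ψ : Config N → ℂ}, Measurable Ψ →
      occupation N φ Ψ ≤
        (N : ℝ≥0∞) * (∫⁻ x, (‖φ x‖₊ : ℝ≥0∞) ^ 2) * ∫⁻ X, (‖Ψ X‖₊ : ℝ≥0∞) ^ 2
  | 0, _, _ => by simp [occupation]
  | n + 1, Ψ, hΨ => by
    have hpt : ∀ Y : Config n, (‖∫ x, conj (φ x) * Ψ (Matrix.vecCons x Y)‖₊ : ℝ≥0∞) ^ 2 ≤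
        (∫⁻ x, (‖Ψ (Matrix.vecCons x Y)‖₊ : ℝ≥0∞) ^ 2) * ∫⁻ x, (‖φ x‖₊ : ℝ≥0∞) ^ 2 := by
      intro Y
      have h := sq_nnnorm_integral_mul_conj_le (ν := (volume : Measure Space))
        (measurable_comp_vecCons_left hΨ Y).aemeasurable hφ
      have hfun : (fun x => conj (φ x) * Ψ (Matrix.vecCons x Y)) =
          fun x => Ψ (Matrix.vecCons x Y) * conj (φ x) := funext fun x => mul_comm _ _
      rwa [hfun]
    calc occupation (n + 1) φ Ψ
        = (n + 1 : ℝ≥0∞) *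
            ∫⁻ Y : Config n, (‖∫ x, conj (φ x) * Ψ (Matrix.vecCons x Y)‖₊ : ℝ≥0∞) ^ 2 := rfl
      _ ≤ (n + 1 : ℝ≥0∞) * ∫⁻ Y : Config n,
            (∫⁻ x, (‖Ψ (Matrix.vecCons x Y)‖₊ : ℝ≥0∞) ^ 2) * ∫⁻ x, (‖φ x‖₊ : ℝ≥0∞) ^ 2 := by
          gcongr with Y
          exact hpt Y
      _ = (n + 1 : ℝ≥0∞) *
            ((∫⁻ X, (‖Ψ X‖₊ : ℝ≥0∞) ^ 2) * ∫⁻ x, (‖φ x‖₊ : ℝ≥0∞) ^ 2) := by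
          rw [lintegral_mul_const _ (measurable_lintegral_sq_nnnorm_vecCons hΨ),
            lintegral_lintegral_sq_nnnorm_vecCons hΨ]
      _ = ((n + 1 : ℕ) : ℝ≥0∞) * (∫⁻ x, (‖φ x‖₊ : ℝ≥0∞) ^ 2) * ∫⁻ X, (‖Ψ X‖₊ : ℝ≥0∞) ^ 2 := by
          push_cast
          ring

/-- **`occ_φ(Θ)^{1/2} ≤ √N`** for a normalised mode `φ` and an admissible (normalised) trial state
`Θ` of `N = n + 1` particles: `γ_Θ ≤ N` as a quadratic form. [cite: LSSY2005, §1.2 (1.18)] -/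
theorem occupation_rpow_half_le_card {n : ℕ} {L : ℝ} {φ : Space → ℂ}
    (hφ : AEStronglyMeasurable φ volume) (hφ1 : ∫⁻ x, (‖φ x‖₊ : ℝ≥0∞) ^ 2 = 1)
    (Θ : TrialState (n + 1) L) :
    occupation (n + 1) φ Θ.ψ ^ (1 / 2 : ℝ) ≤ ((n + 1 : ℕ) : ℝ≥0∞) ^ (1 / 2 : ℝ) := by
  refine ENNReal.rpow_le_rpow ?_ (by norm_num)
  calc occupation (n + 1) φ Θ.ψ
      ≤ ((n + 1 : ℕ) : ℝ≥0∞) * (∫⁻ x, (‖φ x‖₊ : ℝ≥0∞) ^ 2) * ∫⁻ X, (‖Θ.ψ X‖₊ : ℝ≥0∞) ^ 2 :=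
        occupation_le_card_mul_lintegral_mul hφ.aemeasurable Θ.contDiff.continuous.measurable
    _ = ((n + 1 : ℕ) : ℝ≥0∞) := by rw [hφ1, Θ.norm_eq, mul_one, mul_one]

/-- **The occupation of every normalised mode is `2N`-Lipschitz in `L²` on trial states, uniformly
in the mode**: `occ_φ(Φ) ≤ λ_max(γ_Ψ) + 2N ‖Φ - Ψ‖₂` for `Φ, Ψ : TrialState (n+1) L` and every mode
`φ` with `∫ |φ|² = 1`. With `a = occ_φ(Φ)^{1/2}`, `b = occ_φ(Ψ)^{1/2}`: `a ≤ b + √N‖Φ - Ψ‖₂`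
(`√occ_φ` is a seminorm dominated by `√N‖·‖₂`), `a, b ≤ √N`, so
`a² ≤ b² + (a - b)(a + b) ≤ b² + √N‖Φ - Ψ‖₂ · 2√N` and `b² ≤ λ_max(γ_Ψ)`.
[cite: LSSY2005, §1.2 (1.17)–(1.18)] -/
theorem occupation_le_maxOccupation_add {n : ℕ} {L : ℝ} (Φ Ψ : TrialState (n + 1) L)
    {φ : Space → ℂ} (hφ : AEStronglyMeasurable φ volume)
    (hφ1 : ∫⁻ x, (‖φ x‖₊ : ℝ≥0∞) ^ 2 = 1) :
    occupation (n + 1) φ Φ.ψ ≤ maxOccupation (n + 1) Ψ.ψ +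
      2 * ((n + 1 : ℕ) : ℝ≥0∞) * (∫⁻ X, (‖Φ.ψ X - Ψ.ψ X‖₊ : ℝ≥0∞) ^ 2) ^ (1 / 2 : ℝ) := by
  -- `(x^{1/2})² = x`
  have hsq : ∀ x : ℝ≥0∞, (x ^ (1 / 2 : ℝ)) ^ 2 = x := fun x => by
    rw [← ENNReal.rpow_two, ← ENNReal.rpow_mul]
    norm_num
  -- the seminorm property with the bound `occ_φ(Φ - Ψ)^{1/2} ≤ √N ‖Φ - Ψ‖₂` built in (phase `1`)
  have habd := SwapToZeroMode.occupation_rpow_half_le_add hφ hφ1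
    Φ.contDiff.continuous.measurable Ψ.contDiff.continuous.measurable (c := 1) norm_one
  simp only [one_mul] at habd
  calc occupation (n + 1) φ Φ.ψ = (occupation (n + 1) φ Φ.ψ ^ (1 / 2 : ℝ)) ^ 2 := (hsq _).symm
    _ ≤ (occupation (n + 1) φ Ψ.ψ ^ (1 / 2 : ℝ)) ^ 2 +
          2 * (((n + 1 : ℕ) : ℝ≥0∞) ^ (1 / 2 : ℝ) * ((n + 1 : ℕ) : ℝ≥0∞) ^ (1 / 2 : ℝ)) *
            (∫⁻ X, (‖Φ.ψ X - Ψ.ψ X‖₊ : ℝ≥0∞) ^ 2) ^ (1 / 2 : ℝ) :=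
        sq_le_sq_add_of_le_add habd (occupation_rpow_half_le_card hφ hφ1 Φ)
          (occupation_rpow_half_le_card hφ hφ1 Ψ) le_rfl
    _ = occupation (n + 1) φ Ψ.ψ +
          2 * ((n + 1 : ℕ) : ℝ≥0∞) * (∫⁻ X, (‖Φ.ψ X - Ψ.ψ X‖₊ : ℝ≥0∞) ^ 2) ^ (1 / 2 : ℝ) := by
        rw [hsq, ← sq, hsq]
    _ ≤ maxOccupation (n + 1) Ψ.ψ +
          2 * ((n + 1 : ℕ) : ℝ≥0∞) * (∫⁻ X, (‖Φ.ψ X - Ψ.ψ X‖₊ : ℝ≥0∞) ^ 2) ^ (1 / 2 : ℝ) := by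
        gcongr
        exact occupation_le_maxOccupation _ hφ hφ1

/-- **Stub 2c — MaxOccupationStability (`L²`-Lipschitz bound for `λ_max(γ_Ψ)` on trial states).**
For admissible trial states `Φ, Ψ` of `N` bosons in the box `Λ_L`:
`λ_max(γ_Φ) ≤ λ_max(γ_Ψ) + 2N ‖Φ - Ψ‖_{L²}`, where `λ_max(γ_Ψ) = maxOccupation N Ψ` is the supremum
of the occupations `⟨φ, γ_Ψ φ⟩` over normalised a.e.-strongly measurable modes `φ`. The supremum
over modes of `occupation_le_maxOccupation_add`; for `N = 0` every occupation is `0`.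
[cite: LSSY2005, §1.2 (1.17)–(1.19)] -/
theorem stub_maxOccupationStability :
    ∀ (N : ℕ) (L : ℝ) (Φ Ψ : Literature.MathematicalPhysics.QuantumManyBody.BoseGas.TrialState N L),
      Literature.MathematicalPhysics.QuantumManyBody.BoseGas.maxOccupation N Φ.ψ ≤
        Literature.MathematicalPhysics.QuantumManyBody.BoseGas.maxOccupation N Ψ.ψ +
          2 * (N : ENNReal) * (∫⁻ X, (‖Φ.ψ X - Ψ.ψ X‖₊ : ENNReal) ^ 2) ^ (1 / 2 : ℝ) := by
  rintro (_ | n) L Φ Ψ <;> refine iSup₂_le fun φ hφ => ?_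
  · simp [occupation]
  · exact occupation_le_maxOccupation_add Φ Ψ hφ.1 hφ.2

end Summit.AtomisticToContinuum.BoseEinsteinCondensation.Cruxes.HardCoreDominates.Birth

end
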